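import Literature.RingTheory.SimpleModule.SemisimpleRetraction
import Literature.AlgebraicGeometry.Motives.TateAbelianFiniteEndAlgebraProofs
import Literature.NumberTheory.DiophantineGeometry.AVIsogenyTateHomKernelProofs
import Literature.AlgebraicGeometry.Motives.AbelianVarietyTheoremOfCubeProofs
import HarnessLib

/-!
# Descent of the semisimplicity of `End⁰` along Galois-type retractions; Tate's theorem over a
# finite field from inputs over the algebraic closure

Tate's Main Theorem over a finite field `K` (`tate_bijective_of_finite A B ℓ`,
`Motives/TateAbelianFinite`; J. Tate, *Endomorphisms of abelian varieties over finite fields*,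
Invent. Math. 2 (1966), Main Theorem) is assembled in this directory
(`tate_bijective_of_finite_of_endAlgebra_of_module_finite_hom`, `TateAbelianFiniteEndAlgebraProofs`)
from the finite-field inputs `finite_isoClasses_of_finite`, `exists_quotient_isogeny` and two
consequences of Mumford §19 for `P = A ⊞ B` **over `K` itself**: `End_K(P)` finitely generated
(`module_finite_hom P P`) and `End⁰_K(P)` semisimple. The tree now proves both §19 inputs from the
Theorem of the Cube and Poincaré's complete reducibility theorem, but the second one — "a non-zero
homomorphism of simple abelian varieties is an isogeny", `AbelianVariety.hsimple_of_isAlgClosed`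
(`Motives/AbelianVarietyKernelComponent`) — only over an **algebraically closed** field, Mumford's
standing hypothesis. Finite generation descends trivially along the injection
`End_K(P) ↪ End_K̄(P_K̄)` (`module_finite_hom_of_theoremOfCube_of_poincare_algebraicClosure`,
`DiophantineGeometry/AVIsogenyTateHomKernelProofs`); semisimplicity does **not** descend to
arbitrary subalgebras (upper triangular matrices in `M₂(ℚ)`), but it does descend to the fixed
subalgebra of a finite group of automorphisms of invertible order (M. Cohen, S. Montgomery 1975;
`Literature.RingTheory.SimpleModule.isSemisimpleRing_fixedPoints`) and, more generally, along any
bimodule retraction (`isSemisimpleRing_of_retraction`, `isSemisimpleRing_ratTensor_of_trace`).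

This file records the resulting descent statements for endomorphism algebras of abelian varieties,
with the Galois-descent input kept **abstract** (a ring homomorphism `φ : End P → End P'` to the
endomorphism ring of an abelian variety over another field, e.g. `f ↦ f_L`, and either an
`End P`-bimodule trace `τ : End P' → End P` with `τ ∘ φ = n`, or a group `Γ` acting on `End P'`
through finitely many ring automorphisms, fixing `φ(End P)` and such that fixed elements descend):

* `AbelianVariety.isSemisimpleRing_endAlgebra_of_trace` — `End⁰(P')` semisimple ⇒ `End⁰(P)`
  semisimple, given `φ`, `τ`, `n ≠ 0`;
* `AbelianVariety.isSemisimpleRing_endAlgebra_of_fixedPoints` — the same given `φ` injective with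
  image the fixed ring of `Γ` (the trace `τ(r) = φ⁻¹(∑_{σ ∈ Φ} σ(r))` over the finite image `Φ`
  of `Γ` is such a `τ`, with `n = |Φ|`); `…_of_finite` for `Γ` finite;
* `tate_bijective_of_finite_of_theoremOfCube_of_poincare_algebraicClosure_of_galoisDescent`,
  `tate_end_bijective_of_finite_of_theoremOfCube_of_poincare_algebraicClosure_of_galoisDescent` —
  **Tate's Main Theorem (`Hom` and `End` forms) over a finite field `K` from: the Theorem of the
  Cube (`theoremOfCube_linEquiv`), Poincaré's complete reducibility theorem over `K̄` (`hP1`),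
  `finite_isoClasses_of_finite K (dim (A ⊞ B))`, `exists_quotient_isogeny (A ⊞ B) ℓ`, and Galois
  descent for endomorphisms of `(A ⊞ B)_K̄`** (an action of a group `Γ` — e.g. `Gal(K̄/K)`, which
  acts through a finite quotient since `End_K̄` is finitely generated — on `End((A ⊞ B)_K̄)` by ring
  automorphisms with finite image, fixing the base changes `f_K̄` and such that every fixed
  endomorphism is a base change). "Simple ⇒ isogeny" is supplied over `K̄` by
  `hsimple_of_isAlgClosed`, `End⁰((A ⊞ B)_K̄)` is semisimple by
  `isSemisimpleRing_endAlgebra_of_mumford19`, and semisimplicity descends to `End⁰(A ⊞ B)` by the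
  fixed-ring theorem. This removes the hypothesis `hsimple` over the finite field `K` from
  `tate_bijective_of_finite_of_theoremOfCube_of_poincare` (`TateAbelianFiniteCubeProofs`) and moves
  `hP1` to `K̄`, at the price of the Galois-descent hypotheses, which are standard
  (Milne 1986, §16 and proof of Thm. 12.5 over arbitrary fields; Görtz–Wedhorn I, §14.20, Galois
  descent of morphisms) but not yet in the tree for homomorphisms of abelian varieties;
  `tate_bijective_of_finite_of_pseudoCoherent_general_of_poincare_algebraicClosure_of_galoisDescent`
  is the same with the Theorem of the Cube replaced by its current trust base in the tree, the
  named fact `cechComplex_pseudoCoherent_general` (Görtz–Wedhorn II, Thm. 23.133 / Cor. 23.135;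
  `theoremOfCube_linEquiv_of_pseudoCoherent_general`).

No definition, no named fact, no `_holds` (D-0026); the residual inputs are hypotheses.

## References

* [Tate1966Endomorphisms] J. Tate, *Endomorphisms of abelian varieties over finite fields*,
  Invent. Math. 2 (1966), 134–144, Main Theorem (not held, doi:10.1007/bf01404549; statement and
  proof architecture as reported in Milne, *The Work of John Tate*, §4.3 (arXiv:1210.7459, held)).
* [MumfordAV1970] D. Mumford, *Abelian Varieties* (1970), §19 Thm. 1, Cor. 2 of Thm. 1 (p. 174),
  Thm. 3.
* [Milne1986AbelianVarieties] J. S. Milne, *Abelian Varieties*, in Cornell–Silverman (1986), §12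
  (p. 122: `End⁰(A)` is a finite-dimensional semisimple `ℚ`-algebra, over an arbitrary field),
  Thm. 12.5, Cor. 18.9 (held: `book:cornellnd-arithmetic-geometry`, PDF pp. 188–190, read).
* [CohenMontgomery1975] M. Cohen, S. Montgomery, *Semi-simple artinian rings of fixed points*,
  Canad. Math. Bull. 18 (1975), 189–190, Theorem.

## Design

Theorems only; `noncomputable section`; the base field `K : Type u` and the auxiliary field
`L : Type v` of `P'` are universe-independent in the descent lemmas; in the Tate assemblies
`L = AlgebraicClosure K : Type u` and `φ = f ↦ f_K̄` is Mathlib's `Functor.mapEnd` of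
`baseChangeFunctor K K̄` made a ring homomorphism by `RingHom.mk'` and `Hom.baseChange_add`
(injective by `Hom.baseChange_injective`), written inside the proof so that the hypotheses mention
only `Hom.baseChange`. The action of `Γ` is a Mathlib `MulSemiringAction Γ (End P')` instance
argument; elements of `End P'` coming from morphisms are wrapped in `End.of`.
-/

noncomputable section

universe u v

open CategoryTheory CategoryTheory.Limits AlgebraicGeometry
open scoped TensorProduct

namespace Literature.AlgebraicGeometry.Motives

namespace AbelianVariety

/-! ## Descent of semisimplicity of `End⁰` -/

section Descent

variable {K : Type u} [Field K] {L : Type v} [Field L] {P : AbelianVariety K} {P' : AbelianVariety L}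

/-- **Semisimplicity of `End⁰(P)` from that of `End⁰(P')` along an integral trace.** Let
`φ : End P → End P'` be a ring homomorphism (e.g. base change `f ↦ f_L`) and `τ : End P' → End P`
an additive `End P`-bimodule map (`τ (φ a · r) = a · τ r`, `τ (r · φ b) = τ r · b`) with
`τ 1 = n ≠ 0` (e.g. the Galois trace). If `End⁰(P') = ℚ ⊗ End P'` is semisimple then so is
`End⁰(P) = ℚ ⊗ End P` (`Literature.RingTheory.SimpleModule.isSemisimpleRing_ratTensor_of_trace`:
`n⁻¹ (ℚ ⊗ τ)` is a bimodule retraction of `ℚ ⊗ φ`). [folklore] -/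
theorem isSemisimpleRing_endAlgebra_of_trace (φ : End P →+* End P') (τ : End P' →+ End P)
    (n : ℕ) (hn : n ≠ 0) (hl : ∀ (a : End P) (r : End P'), τ (φ a * r) = a * τ r)
    (hr : ∀ (r : End P') (b : End P), τ (r * φ b) = τ r * b) (h1 : τ 1 = n)
    (hss : IsSemisimpleRing (endAlgebra P')) : IsSemisimpleRing (endAlgebra P) :=
  -- `endAlgebra P = ℚ ⊗[ℤ] End P` by definition; the instance argument is passed explicitly
  @Literature.RingTheory.SimpleModule.isSemisimpleRing_ratTensor_of_trace (End P) (End P') _ _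
    φ τ n hn hl hr h1 hss

/-- **Semisimplicity of `End⁰(P)` descends from `End⁰(P')` when `End P` is the fixed ring of a
group acting on `End P'` through finitely many automorphisms** (Cohen–Montgomery 1975 / the
Galois trace). Let `φ : End P → End P'` be an injective ring homomorphism, `Γ` a group acting on
`End P'` by ring automorphisms through a finite set `Φ` of ring endomorphisms, fixing `φ(End P)`
pointwise, such that every `Γ`-fixed element of `End P'` lies in `φ(End P)`. If `End⁰(P')` is
semisimple, so is `End⁰(P)`: the trace `τ(r) = φ⁻¹(∑_{σ ∈ Φ} σ r)` is an `End P`-bimodule map with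
`τ 1 = |Φ| ≠ 0` (`isSemisimpleRing_endAlgebra_of_trace`). Intended use: `P' = P_L` for a Galois
extension `L / K` (or `L = K̄`), `φ = f ↦ f_L`, `Γ = Gal(L/K)` acting by transport of structure
(through a finite quotient, `End_L(P_L)` being finitely generated), Galois descent of morphisms.
[cite: CohenMontgomery1975, Theorem] -/
theorem isSemisimpleRing_endAlgebra_of_fixedPoints {Γ : Type*} [Group Γ]
    [MulSemiringAction Γ (End P')]
    (hΓ : (Set.range (MulSemiringAction.toRingHom Γ (End P'))).Finite)
    (φ : End P →+* End P') (hφ : Function.Injective φ)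
    (hfix : ∀ (γ : Γ) (a : End P), γ • φ a = φ a)
    (hdesc : ∀ r : End P', (∀ γ : Γ, γ • r = r) → r ∈ Set.range φ)
    (hss : IsSemisimpleRing (endAlgebra P')) : IsSemisimpleRing (endAlgebra P) := by
  classical
  -- the integral trace `tr r = ∑_{σ ∈ Φ} σ r` on `End P'`, with `Γ`-fixed values
  set Φ := hΓ.toFinset with hΦ
  let tr : End P' →+ End P' := ∑ σ ∈ Φ, (σ : End P' →+* End P').toAddMonoidHom
  have htr : ∀ r, tr r = ∑ σ ∈ Φ, σ r := fun r ↦ by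
    simp only [tr, AddMonoidHom.finsetSum_apply, RingHom.toAddMonoidHom_eq_coe,
      AddMonoidHom.coe_coe]
  have htr_fix : ∀ (r : End P') (γ : Γ), γ • tr r = tr r := fun r γ ↦ by
    rw [htr]
    exact Literature.RingTheory.SimpleModule.smul_sum_range_toRingHom hΓ γ r
  have hσφ : ∀ σ ∈ Φ, ∀ a : End P, σ (φ a) = φ a := fun σ hσ a ↦
    Literature.RingTheory.SimpleModule.apply_eq_self_of_mem_toFinset_range hΓ hσ
      (fun γ ↦ hfix γ a)
  -- descend it along `φ`: `φ (τ r) = tr r`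
  have hex : ∀ r : End P', ∃ a : End P, φ a = tr r := fun r ↦ hdesc (tr r) (htr_fix r)
  choose τ₀ hτ₀ using hex
  let τ : End P' →+ End P :=
    { toFun := τ₀
      map_zero' := hφ (by rw [hτ₀, map_zero, map_zero])
      map_add' := fun x y ↦ hφ (by rw [hτ₀, map_add, map_add, hτ₀, hτ₀]) }
  have hτ : ∀ r, φ (τ r) = tr r := fun r ↦ hτ₀ r
  refine isSemisimpleRing_endAlgebra_of_trace φ τ Φ.card
    (Literature.RingTheory.SimpleModule.card_toFinset_range_toRingHom_ne_zero hΓ)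
    (fun a r ↦ hφ ?_) (fun r b ↦ hφ ?_) (hφ ?_) hss
  · rw [hτ, map_mul φ, hτ, htr, htr, Finset.mul_sum]
    exact Finset.sum_congr rfl fun σ hσ ↦ by rw [map_mul, hσφ σ hσ a]
  · rw [hτ, map_mul φ, hτ, htr, htr, Finset.sum_mul]
    exact Finset.sum_congr rfl fun σ hσ ↦ by rw [map_mul, hσφ σ hσ b]
  · rw [hτ, htr, map_natCast, Finset.sum_congr rfl fun σ _ ↦ map_one σ, Finset.sum_const,
      Nat.smul_one_eq_cast]

/-- **Semisimplicity of `End⁰(P)` descends from `End⁰(P')` along the fixed ring of a finite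
group** (`isSemisimpleRing_endAlgebra_of_fixedPoints` with `Γ` finite, e.g. `Γ = Gal(L/K)` for a
finite Galois extension over which all endomorphisms of `P_K̄` are defined).
[cite: CohenMontgomery1975, Theorem] -/
theorem isSemisimpleRing_endAlgebra_of_fixedPoints_of_finite {Γ : Type*} [Group Γ] [Finite Γ]
    [MulSemiringAction Γ (End P')]
    (φ : End P →+* End P') (hφ : Function.Injective φ)
    (hfix : ∀ (γ : Γ) (a : End P), γ • φ a = φ a)
    (hdesc : ∀ r : End P', (∀ γ : Γ, γ • r = r) → r ∈ Set.range φ)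
    (hss : IsSemisimpleRing (endAlgebra P')) : IsSemisimpleRing (endAlgebra P) :=
  isSemisimpleRing_endAlgebra_of_fixedPoints (Set.finite_range _) φ hφ hfix hdesc hss

end Descent

end AbelianVariety

/-! ## Tate's theorem over a finite field from the inputs over `K̄` and Galois descent -/

section Finite

open AbelianVariety

variable {K : Type u} [Field K] (A B : AbelianVariety K) (ℓ : ℕ) [Fact ℓ.Prime]

/-- **Tate 1966, Main Theorem (`Hom` form) over a finite field, from the Theorem of the Cube,
Poincaré's complete reducibility theorem over `K̄`, finiteness of isomorphism classes, quotients,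
and Galois descent for `End((A ⊞ B)_K̄)`.** For abelian varieties `A`, `B` over a field `K` and a
prime `ℓ`, the named fact `tate_bijective_of_finite A B ℓ` (for `K` finite and `(ℓ : K) ≠ 0`,
`ℤ_ℓ ⊗ Hom_K(A, B) → Hom_{Γ_K}(T_ℓ A, T_ℓ B)` is bijective) follows from: the Theorem of the Cube
(`hcube`, Görtz–Wedhorn II Thm. 24.73), Poincaré's theorem `hP1` for abelian varieties over `K̄`
(Mumford §19 Thm. 1), `finite_isoClasses_of_finite K (dim (A ⊞ B))` (Milne 1986 Cor. 18.9),
`exists_quotient_isogeny (A ⊞ B) ℓ` (Mumford §7 Thm. 4), and Galois descent for endomorphisms of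
`P_K̄`, `P = A ⊞ B`: a group `Γ` acting on `End(P_K̄)` by ring automorphisms through finitely many
automorphisms (`hΓ`), fixing every `f_K̄` (`hfix`), such that every `Γ`-fixed endomorphism of
`P_K̄` is some `f_K̄` (`hdesc`). Proof: `End_K(P)` is finitely generated
(`module_finite_hom_of_theoremOfCube_of_poincare_algebraicClosure`, Mumford §19 Thm. 3 with
"simple ⇒ isogeny" over `K̄` from `hsimple_of_isAlgClosed`); `End⁰(P_K̄)` is semisimple
(`isSemisimpleRing_endAlgebra_of_mumford19`, §19 Cor. 2 of Thm. 1) and this descends to `End⁰(P)`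
along `f ↦ f_K̄` (`isSemisimpleRing_endAlgebra_of_fixedPoints`, injective by
`Hom.baseChange_injective`); conclude by `tate_bijective_of_finite_of_endAlgebra_of_module_finite_hom`.
[cite: Tate1966Endomorphisms, Main Theorem] -/
theorem tate_bijective_of_finite_of_theoremOfCube_of_poincare_algebraicClosure_of_galoisDescent
    (hcube : theoremOfCube_linEquiv.{u})
    (hP1 : ∀ (X Y : AbelianVariety (AlgebraicClosure K)) (i : Y ⟶ X),
      IsClosedImmersion (Hom.toSchemeHom i) → 0 < Y.dim → Y.dim < X.dim →
      ∃ (Z : AbelianVariety (AlgebraicClosure K)) (j : Z ⟶ X),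
        IsClosedImmersion (Hom.toSchemeHom j) ∧ IsIsogeny (biprod.desc i j))
    (hfin : finite_isoClasses_of_finite K (A ⊞ B).dim) (hq : exists_quotient_isogeny (A ⊞ B) ℓ)
    {Γ : Type*} [Group Γ]
    [MulSemiringAction Γ (End ((A ⊞ B).baseChange (AlgebraicClosure K)))]
    (hΓ : (Set.range (MulSemiringAction.toRingHom Γ
      (End ((A ⊞ B).baseChange (AlgebraicClosure K))))).Finite)
    (hfix : ∀ (γ : Γ) (f : End (A ⊞ B)),
      γ • End.of (Hom.baseChange (AlgebraicClosure K) f) =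
        End.of (Hom.baseChange (AlgebraicClosure K) f))
    (hdesc : ∀ r : End ((A ⊞ B).baseChange (AlgebraicClosure K)), (∀ γ : Γ, γ • r = r) →
      ∃ f : End (A ⊞ B), End.of (Hom.baseChange (AlgebraicClosure K) f) = r) :
    tate_bijective_of_finite A B ℓ :=
  -- base change of endomorphisms as a ring homomorphism `φ : End P → End P_K̄`
  let φ : End (A ⊞ B) →+* End ((A ⊞ B).baseChange (AlgebraicClosure K)) :=
    RingHom.mk' ((baseChangeFunctor K (AlgebraicClosure K)).mapEnd (A ⊞ B))
      (fun f g ↦ Hom.baseChange_add (AlgebraicClosure K) f g)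
  have hφ : ∀ f : End (A ⊞ B), φ f = End.of (Hom.baseChange (AlgebraicClosure K) f) :=
    fun _ ↦ rfl
  have hφinj : Function.Injective φ := fun _ _ hfg ↦
    Hom.baseChange_injective (AlgebraicClosure K) hfg
  have hss' : IsSemisimpleRing (endAlgebra ((A ⊞ B).baseChange (AlgebraicClosure K))) :=
    isSemisimpleRing_endAlgebra_of_mumford19 hP1 (hsimple_of_isAlgClosed (AlgebraicClosure K)) _
  have hss : IsSemisimpleRing (endAlgebra (A ⊞ B)) :=
    isSemisimpleRing_endAlgebra_of_fixedPoints hΓ φ hφinj (fun γ f ↦ by rw [hφ]; exact hfix γ f)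
      (fun r hr ↦ by
        obtain ⟨f, hf⟩ := hdesc r hr
        exact ⟨f, by rw [hφ, hf]⟩) hss'
  tate_bijective_of_finite_of_endAlgebra_of_module_finite_hom A B ℓ hfin hq hss
    (module_finite_hom_of_theoremOfCube_of_poincare_algebraicClosure hcube hP1 (A ⊞ B) (A ⊞ B))

/-- **Tate 1966, Main Theorem (`Hom` form) over a finite field — the trust base after this file,
granted Galois descent**: `tate_bijective_of_finite A B ℓ` from the pseudo-coherence of the Čech
complex of `𝒪(D)` (`h`, the named fact `cechComplex_pseudoCoherent_general`: Görtz–Wedhorn II,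
Thm. 23.133 / Cor. 23.135, giving the Theorem of the Cube by
`theoremOfCube_linEquiv_of_pseudoCoherent_general`), Poincaré's complete reducibility theorem over
`K̄` (`hP1`), `finite_isoClasses_of_finite K (dim (A ⊞ B))`, `exists_quotient_isogeny (A ⊞ B) ℓ`
and the Galois-descent data `hΓ`, `hfix`, `hdesc` for `End((A ⊞ B)_K̄)`
(`tate_bijective_of_finite_of_theoremOfCube_of_poincare_algebraicClosure_of_galoisDescent`).
[cite: Tate1966Endomorphisms, Main Theorem] -/
theorem tate_bijective_of_finite_of_pseudoCoherent_general_of_poincare_algebraicClosure_of_galoisDescent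
    (h : cechComplex_pseudoCoherent_general.{u})
    (hP1 : ∀ (X Y : AbelianVariety (AlgebraicClosure K)) (i : Y ⟶ X),
      IsClosedImmersion (Hom.toSchemeHom i) → 0 < Y.dim → Y.dim < X.dim →
      ∃ (Z : AbelianVariety (AlgebraicClosure K)) (j : Z ⟶ X),
        IsClosedImmersion (Hom.toSchemeHom j) ∧ IsIsogeny (biprod.desc i j))
    (hfin : finite_isoClasses_of_finite K (A ⊞ B).dim) (hq : exists_quotient_isogeny (A ⊞ B) ℓ)
    {Γ : Type*} [Group Γ]
    [MulSemiringAction Γ (End ((A ⊞ B).baseChange (AlgebraicClosure K)))]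
    (hΓ : (Set.range (MulSemiringAction.toRingHom Γ
      (End ((A ⊞ B).baseChange (AlgebraicClosure K))))).Finite)
    (hfix : ∀ (γ : Γ) (f : End (A ⊞ B)),
      γ • End.of (Hom.baseChange (AlgebraicClosure K) f) =
        End.of (Hom.baseChange (AlgebraicClosure K) f))
    (hdesc : ∀ r : End ((A ⊞ B).baseChange (AlgebraicClosure K)), (∀ γ : Γ, γ • r = r) →
      ∃ f : End (A ⊞ B), End.of (Hom.baseChange (AlgebraicClosure K) f) = r) :
    tate_bijective_of_finite A B ℓ :=
  tate_bijective_of_finite_of_theoremOfCube_of_poincare_algebraicClosure_of_galoisDescent A B ℓ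
    (theoremOfCube_linEquiv_of_pseudoCoherent_general h) hP1 hfin hq hΓ hfix hdesc

/-- **Tate 1966, Main Theorem (`End` form) over a finite field, from the Theorem of the Cube,
Poincaré's theorem over `K̄`, finiteness, quotients and Galois descent for `End((A ⊞ A)_K̄)`**:
the `Hom` form for `(A, A)`
(`tate_bijective_of_finite_of_theoremOfCube_of_poincare_algebraicClosure_of_galoisDescent`) is the
`End` form (`tate_end_bijective_of_finite_of`). [cite: Tate1966Endomorphisms, Main Theorem] -/
theorem tate_end_bijective_of_finite_of_theoremOfCube_of_poincare_algebraicClosure_of_galoisDescent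
    (hcube : theoremOfCube_linEquiv.{u})
    (hP1 : ∀ (X Y : AbelianVariety (AlgebraicClosure K)) (i : Y ⟶ X),
      IsClosedImmersion (Hom.toSchemeHom i) → 0 < Y.dim → Y.dim < X.dim →
      ∃ (Z : AbelianVariety (AlgebraicClosure K)) (j : Z ⟶ X),
        IsClosedImmersion (Hom.toSchemeHom j) ∧ IsIsogeny (biprod.desc i j))
    (hfin : finite_isoClasses_of_finite K (A ⊞ A).dim) (hq : exists_quotient_isogeny (A ⊞ A) ℓ)
    {Γ : Type*} [Group Γ]
    [MulSemiringAction Γ (End ((A ⊞ A).baseChange (AlgebraicClosure K)))]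
    (hΓ : (Set.range (MulSemiringAction.toRingHom Γ
      (End ((A ⊞ A).baseChange (AlgebraicClosure K))))).Finite)
    (hfix : ∀ (γ : Γ) (f : End (A ⊞ A)),
      γ • End.of (Hom.baseChange (AlgebraicClosure K) f) =
        End.of (Hom.baseChange (AlgebraicClosure K) f))
    (hdesc : ∀ r : End ((A ⊞ A).baseChange (AlgebraicClosure K)), (∀ γ : Γ, γ • r = r) →
      ∃ f : End (A ⊞ A), End.of (Hom.baseChange (AlgebraicClosure K) f) = r) :
    tate_end_bijective_of_finite A ℓ :=
  tate_end_bijective_of_finite_of A ℓ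
    (tate_bijective_of_finite_of_theoremOfCube_of_poincare_algebraicClosure_of_galoisDescent A A ℓ
      hcube hP1 hfin hq hΓ hfix hdesc)

end Finite

end Literature.AlgebraicGeometry.Motives
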